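import Mathlib
import Summits.Ventures.PercRepro2.Defs
import Summits.Ventures.PercRepro2.Independence
import Summits.Ventures.PercRepro2.Harris
import Summits.Ventures.PercRepro2.Graph
import Summits.Ventures.PercRepro2.Events

/-!
# (ZC) on the two trivial cut-vertex classes (blind cell PercRepro2, mine-a g28)

In the a₁-deleted picture (MINE-A.md §77.0) the (ZC) expression is
`Z = P(D)·Cov(U, e ∩ L) − P(B)·Cov(U, e ∩ Lᶜ)` with `B = {a₃ ↔ o, a₁ ↮ a₃}`.  Two degenerate classes
are Harris alone:
* **`a₁` separates `a₃` from `o`** (every `a₃–o` connection passes through `a₁`, i.e. `γ ⊆ e`):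
  then `B = ∅` and `Z = P(D)·Cov(U, e ∩ L) ≥ 0`;
* **`o` separates `a₁` from `a₃`** (`e ⊆ L`): then `e ∩ Lᶜ = ∅` and again `Z = P(D)·Cov(U, e ∩ L) ≥ 0`.
Both are stated for arbitrary increasing events `U` (not only cluster up-sets).
-/

namespace Summit.Ventures.PercRepro2

variable {V : Type*} {E : Type*} [Fintype E] [DecidableEq E] {R : Type*} [CommRing R] [LinearOrder R]
  [IsStrictOrderedRing R]

/-- The (ZC) expression is nonnegative whenever the `B`-term vanishes and the `eL`-term is a Harris
covariance: the common core of the two cut-vertex classes. -/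
lemma zc_of_B_eq_zero {p : E → R} (hp : IsProbVec p) {U e L' γ : Set (Config E)}
    (hU : IsUpperSet U) (he : IsUpperSet e) (hL : IsUpperSet L')
    (hB : prob p (eᶜ ∩ L'ᶜ ∩ γ) * (prob p (U ∩ (e ∩ L'ᶜ)) - prob p U * prob p (e ∩ L'ᶜ)) = 0) :
    0 ≤ prob p (eᶜ ∩ L'ᶜ ∩ γᶜ) * (prob p (U ∩ (e ∩ L')) - prob p U * prob p (e ∩ L'))
      - prob p (eᶜ ∩ L'ᶜ ∩ γ) * (prob p (U ∩ (e ∩ L'ᶜ)) - prob p U * prob p (e ∩ L'ᶜ)) := by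
  rw [hB, sub_zero]
  refine mul_nonneg (prob_nonneg hp _) (sub_nonneg.2 ?_)
  exact prob_mul_prob_le_prob_inter hp hU (he.inter hL)

/-- **`a₁` separates `a₃` from `o`**: if every configuration with `a₃ ↔ o` has `a₁ ↔ a₃`, then
(ZC) holds for every increasing event `U`. -/
theorem zc_of_root_separates {ends : E → Sym2 V} {p : E → R} (hp : IsProbVec p) (a₁ a₃ o : V)
    (hsep : connEvent ends a₃ o ⊆ connEvent ends a₁ a₃) {U : Set (Config E)} (hU : IsUpperSet U) :
    let e := connEvent ends a₁ a₃
    let L' := connEvent ends a₁ o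
    let γ := connEvent ends a₃ o
    0 ≤ prob p (eᶜ ∩ L'ᶜ ∩ γᶜ) * (prob p (U ∩ (e ∩ L')) - prob p U * prob p (e ∩ L'))
      - prob p (eᶜ ∩ L'ᶜ ∩ γ) * (prob p (U ∩ (e ∩ L'ᶜ)) - prob p U * prob p (e ∩ L'ᶜ)) := by
  intro e L' γ
  refine zc_of_B_eq_zero hp hU (isUpperSet_connEvent ends a₁ a₃) (isUpperSet_connEvent ends a₁ o) ?_
  have hempty : eᶜ ∩ L'ᶜ ∩ γ = ∅ := by
    ext ω
    simp only [Set.mem_inter_iff, Set.mem_compl_iff, Set.mem_empty_iff_false, iff_false]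
    rintro ⟨⟨h1, _⟩, h2⟩
    exact h1 (hsep h2)
  rw [hempty, prob_empty, zero_mul]

/-- **`o` separates `a₁` from `a₃`**: if every configuration with `a₁ ↔ a₃` has `a₁ ↔ o`, then
(ZC) holds for every increasing event `U`. -/
theorem zc_of_o_separates {ends : E → Sym2 V} {p : E → R} (hp : IsProbVec p) (a₁ a₃ o : V)
    (hsep : connEvent ends a₁ a₃ ⊆ connEvent ends a₁ o) {U : Set (Config E)} (hU : IsUpperSet U) :
    let e := connEvent ends a₁ a₃
    let L' := connEvent ends a₁ o
    let γ := connEvent ends a₃ o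
    0 ≤ prob p (eᶜ ∩ L'ᶜ ∩ γᶜ) * (prob p (U ∩ (e ∩ L')) - prob p U * prob p (e ∩ L'))
      - prob p (eᶜ ∩ L'ᶜ ∩ γ) * (prob p (U ∩ (e ∩ L'ᶜ)) - prob p U * prob p (e ∩ L'ᶜ)) := by
  intro e L' γ
  refine zc_of_B_eq_zero hp hU (isUpperSet_connEvent ends a₁ a₃) (isUpperSet_connEvent ends a₁ o) ?_
  have hempty : e ∩ L'ᶜ = ∅ := by
    ext ω
    simp only [Set.mem_inter_iff, Set.mem_compl_iff, Set.mem_empty_iff_false, iff_false]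
    rintro ⟨h1, h2⟩
    exact h2 (hsep h1)
  rw [hempty, Set.inter_empty, prob_empty]
  ring

end Summit.Ventures.PercRepro2
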